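import Literature.NumberTheory.EllipticCurves.Sprung2012.FineSelmerLeSharpFlatSelmerProofs
import Literature.NumberTheory.EllipticCurves.IwasawaSelmerDualUniquenessProofs
import Literature.NumberTheory.EllipticCurves.KatoFineSelmerDualUniquenessProofs
import Literature.NumberTheory.EllipticCurves.IwasawaNakayamaProofs
import HarnessLib

/-!
# The CANONICAL restriction maps `X(E/K_∞) ↠ X^•(E/K_∞) ↠ X₀(E/K_∞)` between the Pontryagin duals of
# `Sel₀ ≤ Sel^• ≤ Sel_{p^∞}` over a `ℤ_p`-extension, `Λ`-linear and surjective FOR EVERY KEY `γ ∈ Γ_K` (normalised or not)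

`Proofs` file (theorems only: no definition, no named fact, no instance, no `sorry`) in the cluster `Sprung2012`; sequel of
`FineSelmerLeSharpFlatSelmerProofs.lean` (`Sel₀ ≤ Sel^•`, `X^• ↠ X₀` for a topological generator). WHY (cell `bsd-ssimc`, width seat
`cruxlead-stmt-BirchSwinnertonDyer-19875-w3` gen 9, crux `SprungLowerDivisibilityAtThree`, line `chromatic-common-zeros`): the typed Poitou–Tate
input `thm714seq_sharpFlat_poitouTate_functionalModel` (p666901) is stated in NATURAL keying — duals keyed by `γ⁻¹`, which is NOT a
topological generator in the tree's normalised sense (`κ γ⁻¹ = −1`) — and carries its arrows `πY : X ↠ X₀`, `π• : X ↠ X^•` EXISTENTIALLY.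
This file makes those two arrows CANONICAL for every key: the Pontryagin transposes of the inclusions `Sel^• ≤ Sel` (`sharpFlatSelmerInfty_le_selmerInfty`)
and `Sel₀ ≤ Sel` (`WeierstrassCurve.fineSelmerInfty_le_selmerInfty`, here), `Λ`-linear and onto, pinned by `D.toDual (π x) s = S.toDual x s`
(and therefore UNIQUE, `IsDualPair.eq_of_toDual_comp`), with the factorisation `X ↠ X₀` = `(X^• ↠ X₀) ∘ (X ↠ X^•)`. Tool: dual pairs
for an ARBITRARY key (`isDualPair'`: the structure fields + the hypothesis-free local nilpotence `isLocNil_…_sub_one'` of the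
uniqueness files) and the generic functoriality `IsDualPair.exists_linearMap_comp_surjective`.

* §1 `WeierstrassCurve.SelmerDualData.isDualPair'`, `WeierstrassCurve.FineSelmerDualData.isDualPair'`, `SharpFlatSelmerDualData.isDualPair'`
  — dual pairs for `conj_γ − 1`, ANY `γ ∈ Γ_K`.
* §2 `WeierstrassCurve.fineSelmerInfty_le_selmerInfty` (`Sel₀(K_∞, E[p^∞]) ≤ Sel_{p^∞}(E/K_∞)`) and the intertwining of `conj_γ − 1` along
  `Sel^• ≤ Sel`, `Sel₀ ≤ Sel`.
* §3 `SharpFlatSelmerDualData.exists_linearMap_ofSelmerDual` (`X ↠ X^•`), `WeierstrassCurve.FineSelmerDualData.exists_linearMap_ofSelmerDual`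
  (`X ↠ X₀`), `SharpFlatSelmerDualData.exists_linearMap_toFineDual'` (`X^• ↠ X₀`, any key), uniqueness of each, and the factorisation
  `SharpFlatSelmerDualData.toFineDual_comp_ofSelmerDual_eq`.

Nothing about any curve is computed; no named fact is used; BSD / Sprung's Thm. 7.14 / Main Conj. 7.21 are NOT proved by any of this.
References: [Sprung2012] Def. 7.11 (p. 1503), Def. 7.13 and Thm. 7.14 (3) (p. 1504); [Kobayashi2003] (7.17)–(7.21) (p. 12); [GreenbergLNM1716]
§1 p. 60; [Greenberg1989] §0 pp. 101–102 (`S^ι`); tree `IwasawaDualFunctorialityProofs`, `IwasawaSelmerDualUniquenessProofs`,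
`KatoFineSelmerDualUniquenessProofs`, `Sprung2012/SharpFlatSelmerDualExistsProofs` (`isLocNil_…'`).
-/

set_option autoImplicit false

noncomputable section

open scoped Classical

universe u

namespace Literature.NumberTheory.EllipticCurves.Sprung2012

open NumberField IsDedekindDomain Field
open Literature.NumberTheory.EllipticCurves Literature.NumberTheory.EllipticCurves.Kobayashi2003
  Literature.NumberTheory.EllipticCurves.IwasawaDual WeierstrassCurve ZpExtension

variable {K : Type u} [Field K] [NumberField K] (W : WeierstrassCurve K) {p : ℕ} [Fact p.Prime] (κ : ZpExtension K p)
variable {E : Type u} [Field E] [Algebra K E]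

/-! ## §1 Dual pairs for an ARBITRARY key -/

/-- `D : W.SelmerDualData κ γ` is a dual pair for `conj_γ − 1`, for EVERY `γ ∈ Γ_K` (the structure fields and the hypothesis-free local
nilpotence `isLocNil_conjSelmerInfty_sub_one'`). [cite: GreenbergLNM1716, §1 (after Conj. 1.3)] -/
theorem _root_.WeierstrassCurve.SelmerDualData.isDualPair' {γ : absoluteGaloisGroup K} (D : W.SelmerDualData κ γ) :
    IwasawaDual.IsDualPair p (W.conjSelmerInfty κ γ - 1) D.toDual where
  bijective := D.bijective
  T_smul x s := by
    rw [D.toDual_T_smul, IwasawaDual.End_sub_apply, AddMonoid.End.one_apply, map_sub]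
    rfl
  C_smul a x s k hk := D.toDual_C_smul a x s k hk
  locNil := W.isLocNil_conjSelmerInfty_sub_one' κ γ

/-- `Y : W.FineSelmerDualData κ γ` is a dual pair for `conj_γ − 1`, for EVERY `γ ∈ Γ_K`. [cite: GreenbergLNM1716, §1 (after Conj. 1.3)] -/
theorem _root_.WeierstrassCurve.FineSelmerDualData.isDualPair' {γ : absoluteGaloisGroup K} (Y : W.FineSelmerDualData κ γ) :
    IwasawaDual.IsDualPair p (W.conjFineSelmerInfty κ γ - 1) Y.toDual where
  bijective := Y.bijective
  T_smul x s := by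
    rw [Y.toDual_T_smul, IwasawaDual.End_sub_apply, AddMonoid.End.one_apply, map_sub]
    rfl
  C_smul a x s k hk := Y.toDual_C_smul a x s k hk
  locNil := W.isLocNil_conjFineSelmerInfty_sub_one' κ γ

variable (ι : AlgebraicClosure K →ₐ[K] AlgebraicClosure E) (ap : ℤ) (g : absoluteGaloisGroup E) (c : ℕ → localPoints W E)
  (col : Sprung2017.Chroma)

/-- `D : SharpFlatSelmerDualData W κ γ ι ap g c •` is a dual pair for `conj_γ − 1`, for EVERY `γ ∈ Γ_K` (e.g. the natural key `γ⁻¹` of the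
print-keyed duals). [cite: Sprung2012, Def. 7.11 (p. 1503)] [cite: GreenbergLNM1716, §1 (after Conj. 1.3)] -/
theorem SharpFlatSelmerDualData.isDualPair' {γ : absoluteGaloisGroup K} (D : SharpFlatSelmerDualData W κ γ ι ap g c col) :
    IwasawaDual.IsDualPair p (conjSharpFlatSelmerInfty W κ ι ap g c col γ - 1) D.toDual where
  bijective := D.bijective
  T_smul x s := by
    rw [D.toDual_T_smul, IwasawaDual.End_sub_apply, AddMonoid.End.one_apply, map_sub]
    rfl
  C_smul a x s k hk := D.toDual_C_smul a x s k hk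
  locNil := isLocNil_conjSharpFlatSelmerInfty_sub_one' W κ ι ap g c col γ

/-! ## §2 The inclusions and their intertwining with `conj_γ − 1` -/

/-- **`Sel₀(K_∞, E[p^∞]) ≤ Sel_{p^∞}(E/K_∞)`** for the tree's true Selmer conditions (through Kobayashi's `Sel^+`:
`fineSelmerInfty_le_signedSelmerInfty`, `signedSelmerInfty_le_selmerInfty`). [cite: CoatesSujatha2005, §3] [cite: Greenberg1989, §1 p. 98] -/
theorem _root_.WeierstrassCurve.fineSelmerInfty_le_selmerInfty [W.IsElliptic] : W.fineSelmerInfty κ ≤ W.selmerInfty κ :=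
  fun _ hs ↦ signedSelmerInfty_le_selmerInfty W κ 1 (fineSelmerInfty_le_signedSelmerInfty W κ 1 hs)

/-- The inclusion `Sel^• ↪ Sel` intertwines `conj_γ − 1`. [cite: Sprung2012, Def. 7.11 (p. 1503)] -/
theorem inclusion_conjSharpFlatSelmerInfty_sub_one (γ : absoluteGaloisGroup K) (s : sharpFlatSelmerInfty W κ ι ap g c col) :
    AddSubgroup.inclusion (sharpFlatSelmerInfty_le_selmerInfty W κ ι ap g c col)
        ((conjSharpFlatSelmerInfty W κ ι ap g c col γ - 1) s) =
      (W.conjSelmerInfty κ γ - 1) (AddSubgroup.inclusion (sharpFlatSelmerInfty_le_selmerInfty W κ ι ap g c col) s) := by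
  apply Subtype.ext
  rw [AddSubgroup.coe_inclusion, IwasawaDual.End_sub_apply, AddMonoid.End.one_apply, AddSubgroupClass.coe_sub,
    coe_conjSharpFlatSelmerInfty_apply, IwasawaDual.End_sub_apply, AddMonoid.End.one_apply, AddSubgroupClass.coe_sub,
    WeierstrassCurve.coe_conjSelmerInfty_apply, AddSubgroup.coe_inclusion]

/-- The inclusion `Sel₀ ↪ Sel` intertwines `conj_γ − 1`. [cite: Greenberg1989, §1 p. 98] -/
theorem _root_.WeierstrassCurve.inclusion_conjFineSelmerInfty_sub_one_selmer [W.IsElliptic] (γ : absoluteGaloisGroup K)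
    (s : W.fineSelmerInfty κ) :
    AddSubgroup.inclusion (W.fineSelmerInfty_le_selmerInfty κ) ((W.conjFineSelmerInfty κ γ - 1) s) =
      (W.conjSelmerInfty κ γ - 1) (AddSubgroup.inclusion (W.fineSelmerInfty_le_selmerInfty κ) s) := by
  apply Subtype.ext
  rw [AddSubgroup.coe_inclusion, WeierstrassCurve.coe_conjFineSelmerInfty_sub_one_apply, IwasawaDual.End_sub_apply,
    AddMonoid.End.one_apply, AddSubgroupClass.coe_sub, WeierstrassCurve.coe_conjSelmerInfty_apply, AddSubgroup.coe_inclusion]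

/-! ## §3 The canonical surjections, any key -/

/-- **`X(E/K_∞) ↠ X^•(E/K_∞)`, canonically, for EVERY key.** For any `γ ∈ Γ_K`, `S : W.SelmerDualData κ γ` and
`D : SharpFlatSelmerDualData W κ γ ι ap g c •` there is a SURJECTIVE `Λ`-linear `π : S.X → D.X` transposing `Sel^• ≤ Sel`:
`D.toDual (π x) s = S.toDual x s` (`s ∈ Sel^•`). This is the arrow `H¹_Iw → X → X^•`'s second half in Sprung's (3)/(7.18)_∞ bookkeeping and the
`π•` of `thm714seq_sharpFlat_poitouTate_functionalModel`, now pinned. [cite: Sprung2012, Def. 7.11 (p. 1503), Thm. 7.14 (3) (p. 1504)]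
[cite: GreenbergLNM1716, §1 p. 60] -/
theorem SharpFlatSelmerDualData.exists_linearMap_ofSelmerDual {γ : absoluteGaloisGroup K} (S : W.SelmerDualData κ γ)
    (D : SharpFlatSelmerDualData W κ γ ι ap g c col) :
    ∃ π : S.X →ₗ[IwasawaAlgebra p] D.X, Function.Surjective π ∧
      ∀ (x : S.X) (s : sharpFlatSelmerInfty W κ ι ap g c col),
        D.toDual (π x) s = S.toDual x (AddSubgroup.inclusion (sharpFlatSelmerInfty_le_selmerInfty W κ ι ap g c col) s) :=
  (S.isDualPair' W κ).exists_linearMap_comp_surjective (D.isDualPair' W κ ι ap g c col)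
    (AddSubgroup.inclusion (sharpFlatSelmerInfty_le_selmerInfty W κ ι ap g c col))
    (fun s ↦ inclusion_conjSharpFlatSelmerInfty_sub_one W κ ι ap g c col γ s) (AddSubgroup.inclusion_injective _)

/-- Uniqueness of the transpose `X ↠ X^•`: two additive maps `S.X → D.X` over the inclusion `Sel^• ≤ Sel` coincide.
[cite: GreenbergLNM1716, §1 p. 60] -/
theorem SharpFlatSelmerDualData.ofSelmerDual_unique {γ : absoluteGaloisGroup K} (S : W.SelmerDualData κ γ)
    (D : SharpFlatSelmerDualData W κ γ ι ap g c col) {F G : S.X →+ D.X}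
    (hF : ∀ (x : S.X) (s : sharpFlatSelmerInfty W κ ι ap g c col),
      D.toDual (F x) s = S.toDual x (AddSubgroup.inclusion (sharpFlatSelmerInfty_le_selmerInfty W κ ι ap g c col) s))
    (hG : ∀ (x : S.X) (s : sharpFlatSelmerInfty W κ ι ap g c col),
      D.toDual (G x) s = S.toDual x (AddSubgroup.inclusion (sharpFlatSelmerInfty_le_selmerInfty W κ ι ap g c col) s)) :
    F = G :=
  (D.isDualPair' W κ ι ap g c col).eq_of_toDual_comp _ hF hG

/-- **`X(E/K_∞) ↠ X₀(E/K_∞)`, canonically, for EVERY key**: for any `γ`, `S : W.SelmerDualData κ γ`, `Y : W.FineSelmerDualData κ γ`,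
a SURJECTIVE `Λ`-linear `πY : S.X → Y.X` with `Y.toDual (πY x) s = S.toDual x s` (`s ∈ Sel₀`) — the arrow `X(E/K_∞) → X⁰(E/K_∞) → 0`
of (7.18)_∞ and the `πY` of `thm714seq_sharpFlat_poitouTate_functionalModel`, pinned. [cite: Kobayashi2003, (7.18)–(7.20) (p. 12)]
[cite: Sprung2012, Def. 7.13 (p. 1504)] [cite: GreenbergLNM1716, §1 p. 60] -/
theorem _root_.WeierstrassCurve.FineSelmerDualData.exists_linearMap_ofSelmerDual [W.IsElliptic] {γ : absoluteGaloisGroup K}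
    (S : W.SelmerDualData κ γ) (Y : W.FineSelmerDualData κ γ) :
    ∃ πY : S.X →ₗ[IwasawaAlgebra p] Y.X, Function.Surjective πY ∧
      ∀ (x : S.X) (s : W.fineSelmerInfty κ),
        Y.toDual (πY x) s = S.toDual x (AddSubgroup.inclusion (W.fineSelmerInfty_le_selmerInfty κ) s) :=
  (S.isDualPair' W κ).exists_linearMap_comp_surjective (Y.isDualPair' W κ)
    (AddSubgroup.inclusion (W.fineSelmerInfty_le_selmerInfty κ))
    (fun s ↦ W.inclusion_conjFineSelmerInfty_sub_one_selmer κ γ s) (AddSubgroup.inclusion_injective _)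

/-- **`X^•(E/K_∞) ↠ X₀(E/K_∞)` for EVERY key** (the any-key form of `SharpFlatSelmerDualData.exists_linearMap_toFineDual`, at the place
`v`, `ι = closureEmb`). [cite: Sprung2012, Thm. 7.14 with (3) (p. 1504)] [cite: Kobayashi2003, (7.21) (p. 13)] -/
theorem SharpFlatSelmerDualData.exists_linearMap_toFineDual' [W.IsElliptic] {γ : absoluteGaloisGroup K} {v : HeightOneSpectrum (𝓞 K)}
    {g : absoluteGaloisGroup (v.adicCompletion K)} {c : ℕ → localPoints W (v.adicCompletion K)}
    (D : SharpFlatSelmerDualData W κ γ (closureEmb (K := K) (v.adicCompletion K)) ap g c col) (Y : W.FineSelmerDualData κ γ) :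
    ∃ k : D.X →ₗ[IwasawaAlgebra p] Y.X, Function.Surjective k ∧
      ∀ (x : D.X) (s : W.fineSelmerInfty κ),
        Y.toDual (k x) s = D.toDual x (AddSubgroup.inclusion (fineSelmerInfty_le_sharpFlatSelmerInfty W κ v ap g c col) s) :=
  (D.isDualPair' W κ _ ap g c col).exists_linearMap_comp_surjective (Y.isDualPair' W κ)
    (AddSubgroup.inclusion (fineSelmerInfty_le_sharpFlatSelmerInfty W κ v ap g c col))
    (fun s ↦ inclusion_conjFineSelmerInfty_sub_one_sharpFlat W κ v ap g c col γ s) (AddSubgroup.inclusion_injective _)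

/-- **The restriction maps compose**: for ANY additive maps `π : X → X^•` over `Sel^• ≤ Sel`, `k : X^• → X₀` over `Sel₀ ≤ Sel^•` and
`πY : X → X₀` over `Sel₀ ≤ Sel` (each pinned by its `toDual` identity), `πY = k ∘ π` — so `ker π ≤ ker πY`, and the local conditions
of Sprung's (3) and (7.18)_∞ are nested as they should be. Uniqueness of transposes (`IsDualPair.eq_of_toDual_comp`).
[cite: Sprung2012, Def. 7.11, 7.13, Thm. 7.14 (3) (pp. 1503–1504)] [cite: Kobayashi2003, (7.17)–(7.18) (p. 12)] -/
theorem SharpFlatSelmerDualData.toFineDual_comp_ofSelmerDual_eq [W.IsElliptic] {γ : absoluteGaloisGroup K}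
    {v : HeightOneSpectrum (𝓞 K)} {g : absoluteGaloisGroup (v.adicCompletion K)} {c : ℕ → localPoints W (v.adicCompletion K)}
    (S : W.SelmerDualData κ γ) (D : SharpFlatSelmerDualData W κ γ (closureEmb (K := K) (v.adicCompletion K)) ap g c col)
    (Y : W.FineSelmerDualData κ γ) {π : S.X →+ D.X} {k : D.X →+ Y.X} {πY : S.X →+ Y.X}
    (hπ : ∀ (x : S.X) (s : sharpFlatSelmerInfty W κ (closureEmb (K := K) (v.adicCompletion K)) ap g c col),
      D.toDual (π x) s =
        S.toDual x (AddSubgroup.inclusion (sharpFlatSelmerInfty_le_selmerInfty W κ (closureEmb (K := K) (v.adicCompletion K)) ap g c col) s))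
    (hk : ∀ (x : D.X) (s : W.fineSelmerInfty κ),
      Y.toDual (k x) s = D.toDual x (AddSubgroup.inclusion (fineSelmerInfty_le_sharpFlatSelmerInfty W κ v ap g c col) s))
    (hπY : ∀ (x : S.X) (s : W.fineSelmerInfty κ),
      Y.toDual (πY x) s = S.toDual x (AddSubgroup.inclusion (W.fineSelmerInfty_le_selmerInfty κ) s)) :
    πY = k.comp π := by
  have key : ∀ (x : S.X) (s : W.fineSelmerInfty κ),
      Y.toDual ((k.comp π) x) s = S.toDual x (AddSubgroup.inclusion (W.fineSelmerInfty_le_selmerInfty κ) s) := by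
    intro x s
    have e : AddSubgroup.inclusion
          (sharpFlatSelmerInfty_le_selmerInfty W κ (closureEmb (K := K) (v.adicCompletion K)) ap g c col)
          (AddSubgroup.inclusion (fineSelmerInfty_le_sharpFlatSelmerInfty W κ v ap g c col) s) =
        AddSubgroup.inclusion (W.fineSelmerInfty_le_selmerInfty κ) s := by
      apply Subtype.ext
      simp only [AddSubgroup.coe_inclusion]
    rw [AddMonoidHom.comp_apply, hk, hπ, e]
  exact (Y.isDualPair' W κ).eq_of_toDual_comp (AddSubgroup.inclusion (W.fineSelmerInfty_le_selmerInfty κ)) hπY key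

end Literature.NumberTheory.EllipticCurves.Sprung2012

end
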